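import Summits.ValiantsHypothesis.ValiantsHypothesis.Theses.FeketeSOS

/-!
# Sketch — crux idea `char-p-isotropic-depth` for `FeketeSOS.FeketeSOSHard` (stmt-ValiantsHypothesis-3996)

First-lemma signatures only (no proofs are claimed here).  Everything is stated over existing
Mathlib declarations; `feketeZ p` is the integer Fekete polynomial, `feketeC p` its image in `ℂ[X]`
(literally the polynomial inlined in the route decls).
-/

open Polynomial
open scoped BigOperators

namespace Summit.ValiantsHypothesis.ValiantsHypothesis.Cruxes.FeketeSOSHard.CharPIsotropicDepth

/-- The Fekete polynomial over `ℤ`: `Σ_{m<p} (m|p) X^m`. -/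
noncomputable def feketeZ (p : ℕ) [Fact p.Prime] : Polynomial ℤ :=
  ∑ m ∈ Finset.range p, C (legendreSym p m) * X ^ m

/-- The Fekete polynomial over `ℂ`, exactly as inlined in the route items. -/
noncomputable def feketeC (p : ℕ) [Fact p.Prime] : Polynomial ℂ :=
  ∑ m ∈ Finset.range p, Polynomial.C ((legendreSym p m : ℤ) : ℂ) * Polynomial.X ^ m

/-- Residue support of a polynomial: the set of exponents mod `p` that occur.  In the local ring
`k[X]/(X^p - 1) = k[t]/(t^p)` (`t = X - 1`, `char k = p`) this is the support of the image. -/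
noncomputable def resSupp {k : Type*} [Semiring k] (p : ℕ) (g : Polynomial k) : Finset ℕ :=
  g.support.image (fun e => e % p)

/-- (provable now) char-`p` Hajós / shallowness: a nonzero polynomial over a field of characteristic
`p` divisible by `(X-1)^m` with `m < p` has at least `m+1` distinct exponent residues mod `p`
(hence at least `m+1` monomials).  Proof: `G(1+t) ≡ Σ_ρ w_ρ (1+t)^ρ (mod t^p)` with
`w_ρ = Σ_{e ≡ ρ} coeff`, then Vandermonde in the residues `ρ`.  The witness `(X-1)^p = X^p - 1`
shows `m < p` is necessary. -/
def CharPShallow : Prop :=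
  ∀ (k : Type) [Field k] (p : ℕ) [Fact p.Prime] [CharP k p] (G : Polynomial k) (m : ℕ),
    G ≠ 0 → m < p → (X - C 1) ^ m ∣ G → m + 1 ≤ (resSupp p G).card

/-- (provable now; Mináč–Nguyen–Tân 2023 Prop. 5.1 / Euler's criterion + vanishing power sums)
exact depth of the Legendre symbol at the prime `p` itself:
`(X-1)^{(p-1)/2} ∥ F_p mod p`. -/
def FeketeModPDepth : Prop :=
  ∀ (p : ℕ) [Fact p.Prime], p ≠ 2 →
    (X - C 1) ^ ((p - 1) / 2) ∣ (feketeZ p).map (Int.castRingHom (ZMod p)) ∧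
    ¬ (X - C 1) ^ ((p - 1) / 2 + 1) ∣ (feketeZ p).map (Int.castRingHom (ZMod p))

/-- THE FIRST LEMMA of the line (new; open for `s ≥ 3`, proved for `s ≤ 2` by additivity of
`ord_{X=1}` over a product): ISOTROPIC DEPTH.  In characteristic `p`, a weighted sum of
`s ≤ p^δ` squares that vanishes at `X = 1` to order EXACTLY `(p-1)/2` has total residue-support
at least `p^{1/2+δ}`.  (Exactness excludes the near-socle digit-tiling identities
`Φ_p = (X-1)^{p-1} = [a]_X [b]_{X^a} + X^{ab}[c]_X`.)  Conjecturally the bound is linear,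
`≥ c·p / poly(s)`. -/
def IsotropicDepth : Prop :=
  ∃ δ₀ : ℝ, 0 < δ₀ ∧ ∀ δ : ℝ, 0 < δ → δ ≤ δ₀ → ∃ p₀ : ℕ, ∀ (p : ℕ) [Fact p.Prime], p₀ ≤ p →
    ∀ (k : Type) [Field k] [CharP k p] (s : ℕ) (c : Fin s → k) (g : Fin s → Polynomial k),
      (s : ℝ) ≤ (p : ℝ) ^ δ →
      (X - C 1) ^ ((p - 1) / 2) ∣ ∑ i, C (c i) * g i ^ 2 →
      ¬ (X - C 1) ^ ((p - 1) / 2 + 1) ∣ ∑ i, C (c i) * g i ^ 2 →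
      (p : ℝ) ^ (1 / 2 + δ) ≤ ∑ i, ((resSupp p (g i)).card : ℝ)

/-- A complex representation `Σ c_i g_i² = F_p` HAS A CHARACTERISTIC-`p` SHADOW when some field of
characteristic `p` carries a representation of `F_p mod p` by at most as many squares with no
larger supports (this is what reduction modulo a prime above `p` produces in the 𝔭-integral
case, "case I"). -/
def HasCharPShadow (p : ℕ) [Fact p.Prime] (s : ℕ) (g : Fin s → Polynomial ℂ) : Prop :=
  ∃ (k : Type) (_ : Field k) (_ : CharP k p) (c' : Fin s → k) (g' : Fin s → Polynomial k),
    (∑ i, C (c' i) * g' i ^ 2 = (feketeZ p).map (Int.castRingHom k)) ∧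
    ∀ i, (g' i).support ⊆ (g i).support

/-- (the honest open half of the line, "case II": the top 𝔭-adic layer of the squares cancels —
an exact sparse isotropic vector `Σ_{l∈L} ε_l A_l² = 0` over the residue field with `|L| ≥ 3`
and `A_l` linearly independent — and `F_p` only appears at a deeper 𝔭-adic layer)
representations WITHOUT a characteristic-`p` shadow are not sparse either. -/
def CaseTwoNotSparse : Prop :=
  ∃ δ₀ : ℝ, 0 < δ₀ ∧ ∀ δ : ℝ, 0 < δ → δ ≤ δ₀ → ∃ p₀ : ℕ, ∀ (p : ℕ) [Fact p.Prime], p₀ ≤ p →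
    ∀ (s : ℕ) (c : Fin s → ℂ) (g : Fin s → Polynomial ℂ),
      (s : ℝ) ≤ (p : ℝ) ^ δ → (∀ i, (g i).natDegree ≤ p ^ 2) →
      (∑ i, Polynomial.C (c i) * g i ^ 2) = feketeC p →
      ¬ HasCharPShadow p s g →
      (p : ℝ) ^ (1 / 2 + δ) ≤ ∑ i, ((g i).support.card : ℝ)

/-- (provable now, pure algebra: Lefschetz/Nullstellensatz to `ℚ̄`, a maximal ideal of `ℤ̄` above
`p`, 𝔭-primitive normalisation of the `g_i`; if `min v(c_i) = 0` reduce) the mod-`p` dichotomy: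
every complex representation either has a characteristic-`p` shadow or is of case II. Stated as
the tautological cover used by the composition; the CONTENT for provers is that "case I"
(minimal weight valuation zero after primitive normalisation) implies `HasCharPShadow`. -/
def CaseOneHasShadow : Prop :=
  ∀ (p : ℕ) [Fact p.Prime] (s : ℕ) (c : Fin s → ℂ) (g : Fin s → Polynomial ℂ),
    (∑ i, Polynomial.C (c i) * g i ^ 2) = feketeC p →
    HasCharPShadow p s g ∨ ¬ HasCharPShadow p s g

/-- Composition target: the three lemmas give the crux BY NAME. (Logic: given a representation
with `s ≤ p^δ`, either it has a char-`p` shadow — then `FeketeModPDepth` pins the exact depth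
`(p-1)/2` of the right-hand side and `IsotropicDepth` bounds the residue supports, which are at
most the supports — or `CaseTwoNotSparse` applies.) -/
def Composition : Prop :=
  FeketeModPDepth → IsotropicDepth → CaseTwoNotSparse →
    Summit.ValiantsHypothesis.ValiantsHypothesis.Theses.FeketeSOS.FeketeSOSHard

/-- Strong form suggested by the lever (any number of squares, any degrees, linear bound):
in `F̄_p[ℤ/p]` the Legendre symbol costs linear support.  Recorded as the natural `C⁺⁺`; NOT
claimed equivalent to the crux. -/
def LinearCharPCost : Prop :=
  ∃ c : ℝ, 0 < c ∧ ∀ (p : ℕ) [Fact p.Prime], p ≠ 2 →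
    ∀ (k : Type) [Field k] [CharP k p] (s : ℕ) (a : Fin s → k) (g : Fin s → Polynomial k),
      (∑ i, C (a i) * g i ^ 2 = (feketeZ p).map (Int.castRingHom k)) →
      c * (p : ℝ) ≤ ∑ i, ((resSupp p (g i)).card : ℝ)

end Summit.ValiantsHypothesis.ValiantsHypothesis.Cruxes.FeketeSOSHard.CharPIsotropicDepth
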